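import Literature.NumberTheory.LFunctions.WeilLineFrame
import HarnessLib

/-!
# `stub_frame`: Duffin–Schaeffer frames of exponentials in Weil vocabulary

Registered stub `stub_frame` of the line `anchor-float` of the crux
`Summit.RiemannHypothesis.RiemannHypothesis.Theses.SpectralTrace.WindowTracePrime2`
(stmt-RiemannHypothesis-11196): for a real sequence `Λ : ℤ → ℝ` uniformly close to the lattice
`ℤ/d` (`|Λ_n - n/d| ≤ M`) and separated (`|Λ_m - Λ_n| ≥ s > 0`), and every window `0 < a < π d`,
there are `0 < A ≤ B` with `A ∫|g|² ≤ Σ_n |ĝ(1/2 + iΛ_n)|² ≤ B ∫|g|²` for every Weil test `g`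
supported in `[-a, a]`, the series being summable. This is Theorem I of Duffin–Schaeffer (1952)
rescaled to density `d`; the whole proof lives in the Literature tree:

* `Literature.NumberTheory.LFunctions.WeilLineSamplingBessel` — Plancherel–Pólya / Bessel upper
  bound and summability (cell Sobolev inequality + Plancherel);
* `Literature.NumberTheory.LFunctions.WeilLineZerosDensity` — zeros of uniform density `d` of the
  transform of a window shorter than `π d` force it to vanish (Jensen's formula);
* `Literature.NumberTheory.LFunctions.WeilLineSupSampling` — Duffin–Schaeffer's sup-norm sampling
  inequality (Beurling's compactness argument + the density theorem);
* `Literature.NumberTheory.LFunctions.WeilLineFrame` — the `L²` lower bound by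
  Duffin–Schaeffer's localisation trick, and the frame theorem `weilMellin_line_frame`.
-/

-- the Summit path `RiemannHypothesis/RiemannHypothesis` (summit = problem) repeats a namespace component
set_option linter.dupNamespace false

noncomputable section

open Complex Set MeasureTheory

namespace Summit.RiemannHypothesis.RiemannHypothesis.Theorems.AnchorFloat

open Literature.NumberTheory.LFunctions

/-- **`stub_frame`** (line `anchor-float`, crux `WindowTracePrime2`): Duffin–Schaeffer frames of
exponentials with frequencies of uniform density `d` on windows shorter than `π d`, in Weil
vocabulary (`ĝ(1/2 + it) = ∫ g(u) e^{itu} du`). [cite: DuffinSchaeffer1952, Theorem I] -/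
theorem stub_frame :
    ∀ (Λ : ℤ → ℝ) (d M s a : ℝ), 0 < d → 0 < s → 0 < a → a < Real.pi * d →
      (∀ n, |Λ n - (n : ℝ) / d| ≤ M) → (∀ m n, m ≠ n → s ≤ |Λ m - Λ n|) →
      ∃ A B : ℝ, 0 < A ∧ A ≤ B ∧
        ∀ g : ℝ → ℂ, Literature.NumberTheory.LFunctions.IsWeilTest g → tsupport g ⊆ Set.Icc (-a) a →
          Summable (fun n =>
            ‖Literature.NumberTheory.LFunctions.weilMellin g (1 / 2 + (Λ n : ℂ) * Complex.I)‖ ^ 2) ∧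
          A * ∫ u, ‖g u‖ ^ 2 ≤
            ∑' n, ‖Literature.NumberTheory.LFunctions.weilMellin g (1 / 2 + (Λ n : ℂ) * Complex.I)‖ ^ 2 ∧
          ∑' n, ‖Literature.NumberTheory.LFunctions.weilMellin g (1 / 2 + (Λ n : ℂ) * Complex.I)‖ ^ 2 ≤
            B * ∫ u, ‖g u‖ ^ 2 :=
  fun Λ d M s a hd hs ha had hΛ hsep => weilMellin_line_frame Λ d M s a hd hs ha had hΛ hsep

end Summit.RiemannHypothesis.RiemannHypothesis.Theorems.AnchorFloat

end
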